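import Summits.QuantumFields.YangMills.Theorems.UnitScaleTiltProp7SolutionHessianLetters
import HarnessLib

/-!
# Route `UnitScaleTilt`, crux K1 «MinimiserStabilityRegPr» (stmt-QuantumFields-19200), EX row (5) `h3` (STOREY H), H-ROAD brick **H7 (★p1 g28 CHAIR WORD №46): THE SUP→SUP
# COVARIANT HESSIAN ROW OF A SOLUTION OF `Δ^η_{U₀}u = ω` AT A PRINTED-REGULAR BACKGROUND** — for ANY site fields `u, ω` with `covLapSite F n K c₀ U₀ u = ω` and the GLOBAL,
# GAUGE-INVARIANT letters `‖u‖_∞ ≤ M_u`, `‖ω‖_∞ ≤ N_ω`, `‖D_{U₀}u‖_∞ ≤ M_w` plus the COVARIANT ½-Hölder letter `H_ω` of `ω` in the local axial gauges: EVERY second covariant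
# derivative `‖covGradT η (bgUnits U₀) (toL2⁻¹(D_{U₀}u)) μ ν x‖ ≤ 2·M₀(ε₀; M_u, N_ω, H_ω, M_w)` — T1-core ✓`Prop7MassiveSolutionGradientSup` (px19 g13) ONE ORDER UP, the local
# row being H4–H6 ✓`Prop7CurvedMemberLocalHessian.exists_curved_localHessian` (px13 g16) instead of (G1-3a).

Cell `ym3-torus` (HUMAN RULING D-0037; rung R3 = SU(2) YM₃ on T³ — NOT d = 4, NOT infinite volume, NOT a mass gap, NOT Clay).  Width seat `ym3-torus-px13` (gen 16);
`--supports stmt-QuantumFields-19200 --as helper`; count-neutral; THEOREMS ONLY (0 `def`, 0 `sorry`, default heartbeats).  LIT-LOCATE #56 (B7) = H-ROAD H7.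

WHY.  The `h3` letter of ✓`Prop7FrakGSupRowsOfWords.gradient_row_frakGT_of_words` is a sup of the (115) covariant derivative of the one-form `D_{U₀}λ₁`, `Δ^η_{U₀}λ₁ = ω₁`
(✓`covLapSite_GprimeP_RS`), i.e. a sup of the covariant HESSIAN of `λ₁`; HESS-T1 ✓`Prop7GaugeModeHessianRow` pays for it with `G_φ = ‖D(Δ^ηψ)‖_∞` — a lattice Calderón–Zygmund word
on rough data (px17 g12 13:43Z).  H4–H6 replaced that currency by the ½-HÖLDER row of `ω` LOCALLY (in a ball, in a gauge `V` that is `δ`-flat there); this file globalises it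
exactly as T1-core globalised (G1-3a): at the bond `p = (x, ν)` pass to the torus axial gauge `V := U₀^{axialT U₀ (e⁻¹x)}` (✓`exists_adIsometries_pointwise`: `Φ`, `Ψ`, the
transported equation ✓`covLapSite_gaugeAct_eq_of_eq`), discharge the NINE letters of `exists_curved_localHessian` — `δ`, `Θ` (✓`Prop7CurvedMemberBallLetters`, ✓`AxialGaugeChartGlue`:
`ℓδ ≤ 48ε₀`, `ℓΘ ≤ 4ε₀(3 + 2457C)`), the plaquette window GLOBALLY from `RegPr V` (✓`regPr_gaugeAct_iff`, ✓`norm_plaqHolU_bgOfCfg_sub_one_lt`, lit ✓`plaqHolU_eq_plaqU`∕✓`plaqU_swap`;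
`α := ε₀`), the current `‖J‖ ≤ ε₀` from `DivSmall V` (✓`Prop7ActionGradCurrent.J_Tsh_bgOfCfg_eq`, lit ✓`J_eq_imPart_div`∕✓`covDivT_eq_divPη`∕✓`norm_imPart_le`: `η⁻³·ε₀η³`), the
local η-gradient letter of the slice `G₂ := G♭ + 2√2·48ε₀·M_w` from any GLOBAL bound `G♭` of the Hessian entries (✓`ell_mul_norm_sub_le_of_rows` on the slice) — read the
centre entry back through ✓`norm_DL2_le`, and absorb `G♭` by the max over the finite bond set (✓`weighted_sup_absorption` at `κ = 0`).  The one new piece of glue (FILE 1∕2): the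
`ν`-SLICE `S_ν A := toL2S (formComp (toL2⁻¹A) ν)` of a bond field reads `(S_ν A)(y) = A(y, ν)` and intertwines the conjugation isometries, `S_ν(ΨA) = Φ(S_ν A)` (source
conjugation of a one-form = site conjugation of its components), so the Hessian entries `‖(D_{U₀}(S_μ(D_{U₀}u)))(p)‖` ARE GAUGE INVARIANT — the `H_ω` letter is the only
gauge-sensitive input, and it is stated covariantly (transported to the centre along the axial tree, = plain differences of `Φ_{axialT U₀ c}ω` by the formula clause).

WHAT IS PROVED (ns `Summit.QuantumFields.YangMills.Theorems.Prop7SolutionHessianSupOfRegPr`; member `F`, heights `n K`, weight `c₀ > 0`; `0 < ε₀ ≤ 1`, `RegPr F n K ε₀ U₀`).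
* (FILE 1∕2 ✓`Prop7SolutionHessianLetters`: the slice glue `equiv_slice_apply`, `slice_adBond_eq_adSite_slice`, ★`norm_equiv_DL2_slice_gaugeAct_eq`, and the two curvature
  letters ★`norm_plaqU_bgOfCfg_sub_one_le`, ★`norm_J_bgOfCfg_le` of `RegPr` on the carrier.)
* §2 ★★ `perBond_hessian_le_of_letters` — per bond `p` and component `μ`: `‖(D_{U₀}(S_μ(D_{U₀}u)))(p)‖ ≤ M₀ + CH·(48ε₀(6√2√10 + 6√2))·G♭` for every global bound `G♭` of the entries.
* §3 ★★★ `norm_equiv_DL2_slice_DL2_le_of_letters` — `‖(D_{U₀}(S_μ(D_{U₀}u)))(p)‖ ≤ 2·M₀` at EVERY bond under the margin `CH·(48ε₀(6√2√10 + 6√2)) ≤ ½`.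
* §4 ★★★ `norm_covGradT_DL2_le_of_holderLetters` — THE LETTER H8 CONSUMES, in HESS-T1's currency VERBATIM: `‖covGradT (eta F n K) (bgUnits F K U₀) (toL2⁻¹(D_{U₀}u)) μ ν x‖ ≤ 2·M₀`
  (✓`DL2_toL2S_eq_covDerivFwdT` + ✓`norm_frobEquiv_le`), `M₀ = CH·(M_w + ((2√2·E·N_ω + H_ω) + 2√2(E·M_w + D·(3√10·(2√2·D·M_w)))) + (6√2·D·(N_ω + 2√2·D·M_w + 2√2·D·M_w) + M_w +
  √2((2ε₀ + 24ε₀²)M_u + 12ε₀·M_w))) + 2√2·D·M_w`, `D = 48ε₀`, `E = 4ε₀(3 + 2457·C)`, `CH := exists_curved_localHessian.choose`, `C := norm_bgOfCfg_axialT_sub_le.choose`.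
HYP-SAT (★★OWNER RULING №42).  `RegPr` (both clauses of print's (8)), `0 < ε₀ ≤ 1`, the equation (an equality), three real sup letters and one Hölder letter (inhabited at fixed data by
finite maxima; K-free on the H-road objects by H1–H3 (sups) and H2 (`H_ω`, [Balaban1985BackgroundPropagators] (3.42)∕[Balaban1984PropagatorsII] (1.40))), `hroom` (T1-core's no-wrap
room, CHAIR WORD №1 class), `hsmall` (smallness of `ε₀` against the universal `CH`); conclusions non-vacuous; no `Prop` hypothesis restates them.  HONEST SCOPE: composition; the
max-principle∕Campanato analysis is (G1-3a)'s, not re-done; nothing of H1–H3, H2, H8, `h3`, norm_G, the EX display, EX `stub_existenceMinimalOrbit`, 19200 or the rung is proved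
here; the Yang–Mills mass gap is NOT proved.

References: T. Bałaban, CMP **99** (1985) 389–434 [Balaban1985BackgroundPropagators] ((3.1)–(3.3) pp.390–391, (3.8)–(3.11) p.392, (3.23)–(3.24) p.394, (3.35) p.396, Thm 3.1
(3.42)–(3.47) pp.397–398); CMP **96** (1984) 223–250 [Balaban1984PropagatorsII] ((1.33) p.229, (1.40) p.230, Lemma 2.1 (2.61)–(2.63) p.234); CMP **102** (1985) 277–309
[Balaban1985Variational] ((2), (8) p.278, (19) p.281, (28) p.282); CMP **98** (1985) 17–51 [Balaban1985Averaging] ((19) p.21, pp.24–25).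
-/

set_option autoImplicit false

noncomputable section

open scoped BigOperators Matrix.Norms.L2Operator InnerProductSpace ComplexConjugate

namespace Summit.QuantumFields.YangMills.Theorems.Prop7SolutionHessianSupOfRegPr

open Literature.MathematicalPhysics.QuantumFieldTheory.Balaban1983to89
open Literature.MathematicalPhysics.QuantumFieldTheory.Balaban1983to89.T3ContinuumYM3Torus
open B10Eq27TorusAxialLog (axialT unitsField toUField)
open B4Sect5Torus (TSite tdist tdist_self tdist_nonneg)
open B9SectCLatticeCarrier (Bond shift tdist_shift_le)
open B9Eq33CovDerivVector (shiftEquiv)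
open B9Eq39Adjoint (plaqU J)
open B9Eq311L2Pairing (WL2)
open B9TorusCalculus (torusT)
open B11Eq103H1Complex (SiteL2K BondL2K)
open B7Prop1Explicit (U1)
open B9Eq310DeltaPrimeJunction (plaqHolU_eq_plaqU)
open B9Eq3117Current (plaqU_swap)
open B11Eq27Current (imPart J_eq_imPart_div norm_imPart_le)
open T3RegularMinimiser (regThreshold)
open T3PrintedRegularMinimiser (RegPr)
open T3PrintedRegularOrbits (regPr_gaugeAct_iff)
open T3SectALandauChart (eta eta_pos eta_pow formComp covGradT bgUnits)
open Summit.QuantumFields.YangMills.Theorems.Prop7SectET3Transport (periodsT3 siteEquiv bondEquiv bondEquiv_apply bgOfCfg)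
open Summit.QuantumFields.YangMills.Theorems.Prop7SectET3HilbertLetters (W₂ frobEquiv toL2 toL2S DL2 DstarL2 covLapSite toL2_apply toL2S_apply toL2_symm_apply)
open Summit.QuantumFields.YangMills.Theorems.Prop7TwoBackgroundGradientComparison (one_le_periodsT3 norm_DL2_le)
open Summit.QuantumFields.YangMills.Theorems.Prop7CurvedMemberLocalHessian (exists_curved_localHessian)
open Summit.QuantumFields.YangMills.Theorems.Prop7WeightedGradientAbsorption (weighted_sup_absorption)
open Summit.QuantumFields.YangMills.Theorems.Prop7GaugeCovariancePointwise (exists_adIsometries_pointwise ell_mul_norm_sub_le_of_rows covLapSite_gaugeAct_eq_of_eq)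
open Summit.QuantumFields.YangMills.Theorems.AxialGaugeChartGlue (norm_bgOfCfg_axialT_sub_le)
open Summit.QuantumFields.YangMills.Theorems.Prop7CurvedMemberBallLetters (natCast_radius norm_bgOfCfg_axialT_sub_one_le_of_ball ell_mul_delta_ball_le ell_mul_theta_ball_le)
open Summit.QuantumFields.YangMills.Theorems.Prop7SectET3WCurrentProp4Rows (bgOfCfg_mem_U1 norm_plaqHolU_bgOfCfg_sub_one_lt)
open B10Eq68TorusRegularity (covDivT)
open Summit.QuantumFields.YangMills.Theorems.Prop7ActionGradCurrent (J_Tsh_bgOfCfg_eq)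
open Summit.QuantumFields.YangMills.Theorems.Prop7SectET3DeltaEtaExplicit (val_inv_bgUnits_eq_star)
open Summit.QuantumFields.YangMills.Theorems.Prop7RieszTauFrobNorm (norm_frobEquiv_le)
open Summit.QuantumFields.YangMills.Theorems.Prop7LandauDict (DL2_toL2S_eq_covDerivFwdT)

variable (F : T3Family) (n K : ℕ) (c₀ : ℝ) [Fact (0 < c₀)]

open Summit.QuantumFields.YangMills.Theorems.Prop7SolutionHessianLetters (equiv_slice_apply norm_equiv_DL2_slice_gaugeAct_eq norm_plaqU_bgOfCfg_sub_one_le norm_J_bgOfCfg_le)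

/-! ## §2 ★★ The per-bond Hessian letter with global sups -/

section PerBond

variable {ε₀ : ℝ} (hε₀ : 0 < ε₀) (hε1 : ε₀ ≤ 1)
  (U₀ : GaugeField (F.P K) 0 (Matrix.specialUnitaryGroup (Fin 2) ℂ)) (hreg : RegPr F n K ε₀ U₀)

include hε₀ hε1 hreg in
/-- ★★ **THE PER-BOND COVARIANT HESSIAN LETTER WITH GLOBAL SUP LETTERS.**  For `u ω` with `Δ^η_{U₀}u = ω`, the three global sups `M_u, N_ω, M_w` (of `u`, `ω`, `D_{U₀}u`), the
covariant ½-Hölder letter `H_ω` of `ω` in the local axial gauges (radius `4ℓ+1`), the no-wrap room at `R = 12ℓ + 4`, a component `μ`, a bond `p`, and every GLOBAL bound `G♭` of the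
Hessian entries `‖(D_{U₀}(S_μ(D_{U₀}u)))(·)‖`:  `‖(D_{U₀}(S_μ(D_{U₀}u)))(p)‖ ≤ M₀ + CH·(48ε₀(6√2√10 + 6√2))·G♭` (`M₀` as in the module docstring, `CH := exists_curved_localHessian.choose`,
`C := norm_bgOfCfg_axialT_sub_le.choose`).  Proof = T1-core's `perBond_gradient_le_of_sup` one order up: gauge `V := U₀^{axialT U₀ (e⁻¹ p.1)}`, `Φ∕Ψ`, transported equation,
`G₂ := G♭ + 2√2·48ε₀·M_w`, H4–H6 ✓`exists_curved_localHessian` at `(V, Φu, Φω, p.1, μ)` with the plaquette∕current letters of §1, read-back ✓`norm_DL2_le`, monotone regrouping.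
[cite: Balaban1985BackgroundPropagators, Thm 3.1 (3.42)–(3.47) pp.397–398, (3.35) p.396; Balaban1984PropagatorsII, (1.40) p.230; Balaban1985Averaging, pp.24-25] -/
theorem perBond_hessian_le_of_letters (u ω : SiteL2K ℂ 3 (periodsT3 F K) c₀ W₂) (hEq : covLapSite F n K c₀ U₀ u = ω)
    {Mu Nω Hω Mw : ℝ} (hMu0 : 0 ≤ Mu) (hNω0 : 0 ≤ Nω) (hHω0 : 0 ≤ Hω) (hMw0 : 0 ≤ Mw)
    (hMu : ∀ y : TSite 3 (periodsT3 F K), ‖WL2.equiv ℂ (fun _ : TSite 3 (periodsT3 F K) => c₀) W₂ u y‖ ≤ Mu)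
    (hNω : ∀ y : TSite 3 (periodsT3 F K), ‖WL2.equiv ℂ (fun _ : TSite 3 (periodsT3 F K) => c₀) W₂ ω y‖ ≤ Nω)
    (hMw : ∀ q : Bond 3 (periodsT3 F K), ‖WL2.equiv ℂ (fun _ : Bond 3 (periodsT3 F K) => c₀) W₂ (DL2 F n K c₀ U₀ u) q‖ ≤ Mw)
    (hHω : ∀ (c : Site (F.P K) 0) (y y' : TSite 3 (periodsT3 F K)),
      tdist (periodsT3 F K) (siteEquiv F K c) y ≤ 4 * (F.L : ℝ) ^ (K - n) + 1 → tdist (periodsT3 F K) (siteEquiv F K c) y' ≤ 4 * (F.L : ℝ) ^ (K - n) + 1 →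
      ‖WL2.equiv ℂ (fun _ : TSite 3 (periodsT3 F K) => c₀) W₂
            (toL2S F K c₀ (fun z => ((axialT U₀ c z : Matrix.specialUnitaryGroup (Fin 2) ℂ) : Matrix (Fin 2) (Fin 2) ℂ) * (toL2S F K c₀).symm ω z * star ((axialT U₀ c z : Matrix.specialUnitaryGroup (Fin 2) ℂ) : Matrix (Fin 2) (Fin 2) ℂ))) y'
          - WL2.equiv ℂ (fun _ : TSite 3 (periodsT3 F K) => c₀) W₂
            (toL2S F K c₀ (fun z => ((axialT U₀ c z : Matrix.specialUnitaryGroup (Fin 2) ℂ) : Matrix (Fin 2) (Fin 2) ℂ) * (toL2S F K c₀).symm ω z * star ((axialT U₀ c z : Matrix.specialUnitaryGroup (Fin 2) ℂ) : Matrix (Fin 2) (Fin 2) ℂ))) y‖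
        ≤ Hω * (tdist (periodsT3 F K) y y' / ((F.L : ℝ) ^ (K - n))) ^ ((1 : ℝ) / 2))
    (hroom : 2 * (12 * F.L ^ (K - n) + 5) ≤ (F.P K).sitesPerDir 0)
    (μ : Fin 3) (p : Bond 3 (periodsT3 F K)) (Gb : ℝ)
    (hGb : ∀ q : Bond 3 (periodsT3 F K), ‖WL2.equiv ℂ (fun _ : Bond 3 (periodsT3 F K) => c₀) W₂
        (DL2 F n K c₀ U₀ (toL2S F K c₀ (formComp ((toL2 F K c₀).symm (DL2 F n K c₀ U₀ u)) μ))) q‖ ≤ Gb) :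
    ‖WL2.equiv ℂ (fun _ : Bond 3 (periodsT3 F K) => c₀) W₂ (DL2 F n K c₀ U₀ (toL2S F K c₀ (formComp ((toL2 F K c₀).symm (DL2 F n K c₀ U₀ u)) μ))) p‖
      ≤ (exists_curved_localHessian.choose *
            (Mw + ((2 * Real.sqrt 2 * (4 * ε₀ * (3 + 2457 * norm_bgOfCfg_axialT_sub_le.choose)) * Nω + Hω)
              + 2 * Real.sqrt 2 * ((4 * ε₀ * (3 + 2457 * norm_bgOfCfg_axialT_sub_le.choose)) * Mw + (48 * ε₀) * (3 * Real.sqrt 10 * (2 * Real.sqrt 2 * (48 * ε₀) * Mw))))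
            + (6 * Real.sqrt 2 * (48 * ε₀) * (Nω + 2 * Real.sqrt 2 * (48 * ε₀) * Mw + 2 * Real.sqrt 2 * (48 * ε₀) * Mw) + Mw
              + Real.sqrt 2 * ((2 * ε₀ + 24 * ε₀ ^ 2) * Mu + 12 * ε₀ * Mw)))
          + 2 * Real.sqrt 2 * (48 * ε₀) * Mw)
        + exists_curved_localHessian.choose * ((48 * ε₀) * (6 * Real.sqrt 2 * Real.sqrt 10 + 6 * Real.sqrt 2)) * Gb := by
  classical
  -- scales and radius
  have hP1 : ∀ i, 1 ≤ periodsT3 F K i := one_le_periodsT3 F K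
  have hL1 : (1 : ℝ) ≤ (F.L : ℝ) := by have := F.hL.2; exact_mod_cast this.le
  have hℓ1 : (1 : ℝ) ≤ (F.L : ℝ) ^ (K - n) := one_le_pow₀ hL1
  have hℓ0 : (0 : ℝ) < (F.L : ℝ) ^ (K - n) := by positivity
  have hη : 0 < eta F n K := eta_pos F n K
  have hη1 : eta F n K ≤ 1 := by
    unfold eta; rw [inv_pow]; exact inv_le_one_of_one_le₀ hℓ1
  set R : ℕ := 12 * F.L ^ (K - n) + 4 with hRdef
  have hRℝ : (R : ℝ) = 12 * (F.L : ℝ) ^ (K - n) + 4 := natCast_radius F n K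
  have hroom' : 2 * (R + 1) ≤ (F.P K).sitesPerDir 0 := by rw [hRdef]; omega
  have hε0 : 0 ≤ ε₀ := hε₀.le
  have hC0 : 0 ≤ norm_bgOfCfg_axialT_sub_le.choose := norm_bgOfCfg_axialT_sub_le.choose_spec.1
  have hCH0 : 0 ≤ exists_curved_localHessian.choose := exists_curved_localHessian.choose_spec.1
  -- the bond, the gauge, the isometries
  set c : Site (F.P K) 0 := (siteEquiv F K).symm p.1 with hc
  set x : TSite 3 (periodsT3 F K) := siteEquiv F K c with hx
  have hxp : x = p.1 := by rw [hx, hc, Equiv.apply_symm_apply]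
  set V : GaugeField (F.P K) 0 (Matrix.specialUnitaryGroup (Fin 2) ℂ) := GaugeField.gaugeAct (axialT U₀ c) U₀ with hV
  have hregV : RegPr F n K ε₀ V := (regPr_gaugeAct_iff F hε0 (axialT U₀ c) U₀).mpr hreg
  obtain ⟨Φ, Ψ, hΦ, hΨ, hP1Φ, -, hU⟩ := exists_adIsometries_pointwise F n K c₀ (axialT U₀ c)
  obtain ⟨hD, -, hΔ, hDpt, -, -⟩ := hU U₀
  clear hU
  -- the radii letters `δ`, `Θ`, the slice `w`, the gradient letter `G₂`
  set δ : ℝ := 3 * (R : ℝ) * regThreshold F n K ε₀ with hδdef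
  have hδ0 : 0 ≤ δ := by rw [hδdef]; unfold regThreshold; positivity
  set Θ : ℝ := (3 * (ε₀ * ((F.L : ℝ)⁻¹) ^ (2 * (K - n))) + (3 : ℝ) ^ 2 * (norm_bgOfCfg_axialT_sub_le.choose * ((ε₀ * ((F.L : ℝ)⁻¹) ^ (2 * (K - n))) +
      R * (ε₀ * ((F.L : ℝ)⁻¹) ^ (3 * (K - n))) + (R : ℝ) ^ 2 * (ε₀ * ((F.L : ℝ)⁻¹) ^ (2 * (K - n))) ^ 2))) * Real.sqrt ((R : ℝ) * (F.L : ℝ) ^ (K - n)) with hΘdef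
  have hΘ0 : 0 ≤ Θ := by
    have : (0 : ℝ) ≤ ((F.L : ℝ)⁻¹) := inv_nonneg.2 (Nat.cast_nonneg _)
    positivity
  have hℓδ : (F.L : ℝ) ^ (K - n) * δ ≤ 48 * ε₀ := by rw [hδdef]; exact ell_mul_delta_ball_le F n K hε0
  have hℓΘ : (F.L : ℝ) ^ (K - n) * Θ ≤ 4 * ε₀ * (3 + 2457 * norm_bgOfCfg_axialT_sub_le.choose) := by
    rw [hΘdef]; exact ell_mul_theta_ball_le F n K hε0 hε1 hC0
  have hΘle : Θ ≤ 4 * ε₀ * (3 + 2457 * norm_bgOfCfg_axialT_sub_le.choose) := (le_mul_of_one_le_left hΘ0 hℓ1).trans hℓΘ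
  set w : SiteL2K ℂ 3 (periodsT3 F K) c₀ W₂ := toL2S F K c₀ (formComp ((toL2 F K c₀).symm (DL2 F n K c₀ V (Φ u))) μ) with hwdef
  have hGb0 : 0 ≤ Gb := (norm_nonneg _).trans (hGb p)
  set Gt : ℝ := Gb + 2 * Real.sqrt 2 * (48 * ε₀) * Mw with hGt
  have hGt0 : 0 ≤ Gt := by positivity
  -- the transported equation
  have htrans : covLapSite F n K c₀ V (Φ u) = Φ ω := covLapSite_gaugeAct_eq_of_eq F n K c₀ (axialT U₀ c) U₀ Φ hΔ hEq
  -- the sup letters transport pointwise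
  have hMuV : ∀ z, ‖WL2.equiv ℂ (fun _ : TSite 3 (periodsT3 F K) => c₀) W₂ (Φ u) z‖ ≤ Mu := fun z => by rw [hP1Φ]; exact hMu z
  have hNωV : ∀ z, ‖WL2.equiv ℂ (fun _ : TSite 3 (periodsT3 F K) => c₀) W₂ (Φ ω) z‖ ≤ Nω := fun z => by rw [hP1Φ]; exact hNω z
  have hMwV : ∀ (z : TSite 3 (periodsT3 F K)) (κ : Fin 3), ‖WL2.equiv ℂ (fun _ : Bond 3 (periodsT3 F K) => c₀) W₂ (DL2 F n K c₀ V (Φ u)) (z, κ)‖ ≤ Mw :=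
    fun z κ => by rw [hV, hDpt]; exact hMw (z, κ)
  -- the Hölder letter: `Φω` IS the axially transported `ω`
  have hΦω : Φ ω = toL2S F K c₀ (fun z => ((axialT U₀ c z : Matrix.specialUnitaryGroup (Fin 2) ℂ) : Matrix (Fin 2) (Fin 2) ℂ) * (toL2S F K c₀).symm ω z
      * star ((axialT U₀ c z : Matrix.specialUnitaryGroup (Fin 2) ℂ) : Matrix (Fin 2) (Fin 2) ℂ)) := by
    conv_lhs => rw [← (toL2S F K c₀).apply_symm_apply ω]
    exact hΦ _
  have hHωV : ∀ y y' : TSite 3 (periodsT3 F K), tdist (periodsT3 F K) x y ≤ 4 * (F.L : ℝ) ^ (K - n) + 1 → tdist (periodsT3 F K) x y' ≤ 4 * (F.L : ℝ) ^ (K - n) + 1 →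
      ‖WL2.equiv ℂ (fun _ : TSite 3 (periodsT3 F K) => c₀) W₂ (Φ ω) y' - WL2.equiv ℂ (fun _ : TSite 3 (periodsT3 F K) => c₀) W₂ (Φ ω) y‖
        ≤ Hω * (tdist (periodsT3 F K) y y' / ((F.L : ℝ) ^ (K - n))) ^ ((1 : ℝ) / 2) := by
    intro y y' hy hy'
    rw [hΦω]
    exact hHω c y y' (by rw [← hx]; exact hy) (by rw [← hx]; exact hy')
  -- the background rows of `V` : `δ` on the big ball, `Θ` on the `4ℓ`-ball
  have hδBall : ∀ (z : TSite 3 (periodsT3 F K)) (κ : Fin 3), tdist (periodsT3 F K) x z ≤ 12 * (F.L : ℝ) ^ (K - n) + 4 →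
      ‖((bgOfCfg F K V (z, κ) : (Matrix (Fin 2) (Fin 2) ℂ)ˣ) : Matrix (Fin 2) (Fin 2) ℂ) - 1‖ ≤ δ := by
    intro z κ hz
    exact norm_bgOfCfg_axialT_sub_one_le_of_ball F n K hε0 U₀ hreg.1 c hroom' z κ (by rw [hRℝ]; exact hz)
  have hΘBall := norm_bgOfCfg_axialT_sub_le.choose_spec.2 F n K ε₀ hε0 hε1 U₀ hreg.1 hreg.2 c x 0 R
    (by rw [hx, B4Sect5Torus.tdist_self]; norm_num) (by omega) hroom'
  -- the plaquette window and the current of `RegPr V`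
  have hpl := norm_plaqU_bgOfCfg_sub_one_le F n K V hregV
  have hJ : ∀ y, tdist (periodsT3 F K) x y ≤ 4 * (F.L : ℝ) ^ (K - n) →
      ‖J (fun μ => shiftEquiv (Pd := periodsT3 F K) μ) (fun μ y => bgOfCfg F K V (y, μ)) (eta F n K) μ y‖ ≤ ε₀ :=
    fun y _ => norm_J_bgOfCfg_le F n K V hregV μ y
  -- the slice and its covariant gradient: the Hessian entries are gauge invariant
  have hwapp : ∀ y, WL2.equiv ℂ (fun _ : TSite 3 (periodsT3 F K) => c₀) W₂ w y = WL2.equiv ℂ (fun _ : Bond 3 (periodsT3 F K) => c₀) W₂ (DL2 F n K c₀ V (Φ u)) (y, μ) :=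
    fun y => equiv_slice_apply F K c₀ _ μ y
  have hginv : ∀ q : Bond 3 (periodsT3 F K), ‖WL2.equiv ℂ (fun _ : Bond 3 (periodsT3 F K) => c₀) W₂ (DL2 F n K c₀ V w) q‖
      = ‖WL2.equiv ℂ (fun _ : Bond 3 (periodsT3 F K) => c₀) W₂ (DL2 F n K c₀ U₀ (toL2S F K c₀ (formComp ((toL2 F K c₀).symm (DL2 F n K c₀ U₀ u)) μ))) q‖ :=
    fun q => by rw [hwdef, hV]; exact norm_equiv_DL2_slice_gaugeAct_eq F n K c₀ (axialT U₀ c) U₀ Φ Ψ hΦ hΨ hD hDpt u μ q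
  -- the η-GRADIENT LETTER OF THE SLICE `G₂ := G♭ + 2√2·(48ε₀)·M_w` on the big ball
  have hG₂ : ∀ (z : TSite 3 (periodsT3 F K)) (ν : Fin 3), tdist (periodsT3 F K) x z ≤ 12 * (F.L : ℝ) ^ (K - n) + 3 →
      (F.L : ℝ) ^ (K - n) * ‖WL2.equiv ℂ (fun _ : Bond 3 (periodsT3 F K) => c₀) W₂ (DL2 F n K c₀ V (Φ u)) (shift ν z, μ) -
        WL2.equiv ℂ (fun _ : Bond 3 (periodsT3 F K) => c₀) W₂ (DL2 F n K c₀ V (Φ u)) (z, μ)‖ ≤ Gt := by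
    intro z ν hz
    have hcov : ‖WL2.equiv ℂ (fun _ : Bond 3 (periodsT3 F K) => c₀) W₂ (DL2 F n K c₀ V w) (z, ν)‖ ≤ Gb := by rw [hginv]; exact hGb (z, ν)
    have h1 := ell_mul_norm_sub_le_of_rows F n K c₀ V w z ν (Mu := Mw) hcov (hδBall z ν (by linarith only [hz])) (by rw [hwapp]; exact hMwV _ _)
    rw [hwapp, hwapp] at h1
    have h2 : 2 * Real.sqrt 2 * ((F.L : ℝ) ^ (K - n) * δ) * Mw ≤ 2 * Real.sqrt 2 * (48 * ε₀) * Mw :=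
      mul_le_mul_of_nonneg_right (mul_le_mul_of_nonneg_left hℓδ (by positivity : (0 : ℝ) ≤ 2 * Real.sqrt 2)) hMw0
    exact h1.trans (add_le_add le_rfl h2)
  -- H4–H6 at `(V, Φu, Φω, x, μ)`
  have hloc := exists_curved_localHessian.choose_spec.2 F n K c₀ V (Φ u) (Φ ω) x μ Nω Hω Mu Mw Gt δ Θ ε₀ ε₀ hNω0 hHω0 hMu0 hMw0 hGt0 hδ0 hΘ0 hε0 hε0 htrans
    (fun y _ => hNωV y) hHωV (fun y _ => hMuV y) (fun y κ _ => hMwV y κ) hG₂ hpl hJ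
    (fun y κ hy => hδBall y κ (by linarith only [hy, hℓ1])) hΘBall p.2
  -- read back `g(p) = ‖(D_V w)(x, p.2)‖`
  have hread : ‖WL2.equiv ℂ (fun _ : Bond 3 (periodsT3 F K) => c₀) W₂ (DL2 F n K c₀ U₀ (toL2S F K c₀ (formComp ((toL2 F K c₀).symm (DL2 F n K c₀ U₀ u)) μ))) p‖
      ≤ (F.L : ℝ) ^ (K - n) * ‖WL2.equiv ℂ (fun _ : Bond 3 (periodsT3 F K) => c₀) W₂ (DL2 F n K c₀ V (Φ u)) (shift p.2 x, μ) -
          WL2.equiv ℂ (fun _ : Bond 3 (periodsT3 F K) => c₀) W₂ (DL2 F n K c₀ V (Φ u)) (x, μ)‖ + 2 * Real.sqrt 2 * (48 * ε₀) * Mw := by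
    have hp : p = (x, p.2) := by rw [hxp]
    rw [← hginv, hp]
    have hx0 : tdist (periodsT3 F K) x x ≤ 12 * (F.L : ℝ) ^ (K - n) + 4 := by rw [B4Sect5Torus.tdist_self]; positivity
    have h1 := norm_DL2_le n V w x p.2
    rw [hwapp, hwapp] at h1
    have h2 : 2 * Real.sqrt 2 * ‖((bgOfCfg F K V (x, p.2) : (Matrix (Fin 2) (Fin 2) ℂ)ˣ) : Matrix (Fin 2) (Fin 2) ℂ) - 1‖
        * ‖WL2.equiv ℂ (fun _ : Bond 3 (periodsT3 F K) => c₀) W₂ (DL2 F n K c₀ V (Φ u)) (shift p.2 x, μ)‖ ≤ 2 * Real.sqrt 2 * δ * Mw :=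
      mul_le_mul (mul_le_mul_of_nonneg_left (hδBall x p.2 hx0) (by positivity)) (hMwV _ _) (norm_nonneg _) (by positivity)
    have h3 : (F.L : ℝ) ^ (K - n) * (2 * Real.sqrt 2 * δ * Mw) ≤ 2 * Real.sqrt 2 * (48 * ε₀) * Mw := by
      have := mul_le_mul_of_nonneg_right (mul_le_mul_of_nonneg_left hℓδ (by positivity : (0 : ℝ) ≤ 2 * Real.sqrt 2)) hMw0
      calc (F.L : ℝ) ^ (K - n) * (2 * Real.sqrt 2 * δ * Mw) = 2 * Real.sqrt 2 * ((F.L : ℝ) ^ (K - n) * δ) * Mw := by ring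
        _ ≤ _ := this
    calc _ ≤ (F.L : ℝ) ^ (K - n) * (‖WL2.equiv ℂ (fun _ : Bond 3 (periodsT3 F K) => c₀) W₂ (DL2 F n K c₀ V (Φ u)) (shift p.2 x, μ) -
              WL2.equiv ℂ (fun _ : Bond 3 (periodsT3 F K) => c₀) W₂ (DL2 F n K c₀ V (Φ u)) (x, μ)‖ + 2 * Real.sqrt 2 * δ * Mw) :=
          h1.trans (mul_le_mul_of_nonneg_left (add_le_add le_rfl h2) hℓ0.le)
      _ = _ := mul_add _ _ _
      _ ≤ _ := add_le_add le_rfl h3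
  -- monotone regrouping: `ℓδ ↦ 48ε₀`, `ℓΘ, Θ ↦ 4ε₀(3 + 2457C)`, `η ↦ 1`
  have hkey := hread.trans (add_le_add hloc le_rfl)
  clear hloc hread hG₂ hginv hwapp hJ hpl hΘBall hδBall hHωV hΦω hMwV hNωV hMuV htrans hD hΔ hDpt hΦ hΨ hP1Φ
  have hmono : exists_curved_localHessian.choose * (Mw + ((2 * Real.sqrt 2 * Θ * Nω + Hω)
          + 2 * Real.sqrt 2 * (((F.L : ℝ) ^ (K - n) * Θ) * Mw + ((F.L : ℝ) ^ (K - n) * δ) * (3 * Real.sqrt 10 * Gt)))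
        + (6 * Real.sqrt 2 * ((F.L : ℝ) ^ (K - n) * δ) * (Nω + Gt + 2 * Real.sqrt 2 * ((F.L : ℝ) ^ (K - n) * δ) * Mw) + Mw
          + Real.sqrt 2 * ((2 * ε₀ + 24 * ε₀ ^ 2 * eta F n K) * Mu + 12 * ε₀ * Mw)))
      + 2 * Real.sqrt 2 * (48 * ε₀) * Mw
      ≤ exists_curved_localHessian.choose * (Mw + ((2 * Real.sqrt 2 * (4 * ε₀ * (3 + 2457 * norm_bgOfCfg_axialT_sub_le.choose)) * Nω + Hω)
          + 2 * Real.sqrt 2 * ((4 * ε₀ * (3 + 2457 * norm_bgOfCfg_axialT_sub_le.choose)) * Mw + (48 * ε₀) * (3 * Real.sqrt 10 * Gt)))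
        + (6 * Real.sqrt 2 * (48 * ε₀) * (Nω + Gt + 2 * Real.sqrt 2 * (48 * ε₀) * Mw) + Mw
          + Real.sqrt 2 * ((2 * ε₀ + 24 * ε₀ ^ 2 * 1) * Mu + 12 * ε₀ * Mw)))
      + 2 * Real.sqrt 2 * (48 * ε₀) * Mw := by
    have hℓδ0 : 0 ≤ (F.L : ℝ) ^ (K - n) * δ := mul_nonneg hℓ0.le hδ0
    gcongr
  have hfin : exists_curved_localHessian.choose * (Mw + ((2 * Real.sqrt 2 * (4 * ε₀ * (3 + 2457 * norm_bgOfCfg_axialT_sub_le.choose)) * Nω + Hω)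
          + 2 * Real.sqrt 2 * ((4 * ε₀ * (3 + 2457 * norm_bgOfCfg_axialT_sub_le.choose)) * Mw + (48 * ε₀) * (3 * Real.sqrt 10 * Gt)))
        + (6 * Real.sqrt 2 * (48 * ε₀) * (Nω + Gt + 2 * Real.sqrt 2 * (48 * ε₀) * Mw) + Mw
          + Real.sqrt 2 * ((2 * ε₀ + 24 * ε₀ ^ 2 * 1) * Mu + 12 * ε₀ * Mw)))
      + 2 * Real.sqrt 2 * (48 * ε₀) * Mw
      = (exists_curved_localHessian.choose * (Mw + ((2 * Real.sqrt 2 * (4 * ε₀ * (3 + 2457 * norm_bgOfCfg_axialT_sub_le.choose)) * Nω + Hω)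
              + 2 * Real.sqrt 2 * ((4 * ε₀ * (3 + 2457 * norm_bgOfCfg_axialT_sub_le.choose)) * Mw
                + (48 * ε₀) * (3 * Real.sqrt 10 * (2 * Real.sqrt 2 * (48 * ε₀) * Mw))))
            + (6 * Real.sqrt 2 * (48 * ε₀) * (Nω + 2 * Real.sqrt 2 * (48 * ε₀) * Mw + 2 * Real.sqrt 2 * (48 * ε₀) * Mw) + Mw
              + Real.sqrt 2 * ((2 * ε₀ + 24 * ε₀ ^ 2) * Mu + 12 * ε₀ * Mw)))
          + 2 * Real.sqrt 2 * (48 * ε₀) * Mw)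
        + exists_curved_localHessian.choose * ((48 * ε₀) * (6 * Real.sqrt 2 * Real.sqrt 10 + 6 * Real.sqrt 2)) * Gb := by
    rw [hGt]; ring
  exact hkey.trans (hmono.trans hfin.le)

end PerBond

/-! ## §3 ★★★ The sup→sup covariant Hessian row (bond currency) -/

section Global

variable {ε₀ : ℝ} (hε₀ : 0 < ε₀) (hε1 : ε₀ ≤ 1)
  (U₀ : GaugeField (F.P K) 0 (Matrix.specialUnitaryGroup (Fin 2) ℂ)) (hreg : RegPr F n K ε₀ U₀)

include hε₀ hε1 hreg in
/-- ★★★ **THE SUP→SUP COVARIANT HESSIAN ROW** ([Balaban1985BackgroundPropagators] Thm 3.1 (3.42)–(3.44), Hessian∕Hölder entry, sup edition at a regular curved background).  For `u ω`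
with `Δ^η_{U₀}u = ω` on the torus, the letters `M_u, N_ω, M_w, H_ω` of §2, the no-wrap room and the absorption margin `CH·(48ε₀(6√2√10 + 6√2)) ≤ ½`:
`‖(D_{U₀}(S_μ(D_{U₀}u)))(p)‖ ≤ 2·M₀` at EVERY bond `p` and component `μ` — §2 with `G♭ := max_q ‖(D_{U₀}(S_μ(D_{U₀}u)))(q)‖`, absorbed by the max over the finite bond set
(✓`weighted_sup_absorption` at `κ = d = D := 0`). [cite: Balaban1985BackgroundPropagators, Thm 3.1 (3.42)–(3.44) pp.397–398; Balaban1984PropagatorsII, Lemma 2.1 (2.61)–(2.63) p.234] -/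
theorem norm_equiv_DL2_slice_DL2_le_of_letters (u ω : SiteL2K ℂ 3 (periodsT3 F K) c₀ W₂) (hEq : covLapSite F n K c₀ U₀ u = ω)
    {Mu Nω Hω Mw : ℝ} (hMu0 : 0 ≤ Mu) (hNω0 : 0 ≤ Nω) (hHω0 : 0 ≤ Hω) (hMw0 : 0 ≤ Mw)
    (hMu : ∀ y : TSite 3 (periodsT3 F K), ‖WL2.equiv ℂ (fun _ : TSite 3 (periodsT3 F K) => c₀) W₂ u y‖ ≤ Mu)
    (hNω : ∀ y : TSite 3 (periodsT3 F K), ‖WL2.equiv ℂ (fun _ : TSite 3 (periodsT3 F K) => c₀) W₂ ω y‖ ≤ Nω)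
    (hMw : ∀ q : Bond 3 (periodsT3 F K), ‖WL2.equiv ℂ (fun _ : Bond 3 (periodsT3 F K) => c₀) W₂ (DL2 F n K c₀ U₀ u) q‖ ≤ Mw)
    (hHω : ∀ (c : Site (F.P K) 0) (y y' : TSite 3 (periodsT3 F K)),
      tdist (periodsT3 F K) (siteEquiv F K c) y ≤ 4 * (F.L : ℝ) ^ (K - n) + 1 → tdist (periodsT3 F K) (siteEquiv F K c) y' ≤ 4 * (F.L : ℝ) ^ (K - n) + 1 →
      ‖WL2.equiv ℂ (fun _ : TSite 3 (periodsT3 F K) => c₀) W₂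
            (toL2S F K c₀ (fun z => ((axialT U₀ c z : Matrix.specialUnitaryGroup (Fin 2) ℂ) : Matrix (Fin 2) (Fin 2) ℂ) * (toL2S F K c₀).symm ω z
              * star ((axialT U₀ c z : Matrix.specialUnitaryGroup (Fin 2) ℂ) : Matrix (Fin 2) (Fin 2) ℂ))) y'
          - WL2.equiv ℂ (fun _ : TSite 3 (periodsT3 F K) => c₀) W₂
            (toL2S F K c₀ (fun z => ((axialT U₀ c z : Matrix.specialUnitaryGroup (Fin 2) ℂ) : Matrix (Fin 2) (Fin 2) ℂ) * (toL2S F K c₀).symm ω z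
              * star ((axialT U₀ c z : Matrix.specialUnitaryGroup (Fin 2) ℂ) : Matrix (Fin 2) (Fin 2) ℂ))) y‖
        ≤ Hω * (tdist (periodsT3 F K) y y' / ((F.L : ℝ) ^ (K - n))) ^ ((1 : ℝ) / 2))
    (hroom : 2 * (12 * F.L ^ (K - n) + 5) ≤ (F.P K).sitesPerDir 0)
    (hsmall : exists_curved_localHessian.choose * ((48 * ε₀) * (6 * Real.sqrt 2 * Real.sqrt 10 + 6 * Real.sqrt 2)) ≤ 1 / 2) :
    ∀ (μ : Fin 3) (p : Bond 3 (periodsT3 F K)),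
      ‖WL2.equiv ℂ (fun _ : Bond 3 (periodsT3 F K) => c₀) W₂ (DL2 F n K c₀ U₀ (toL2S F K c₀ (formComp ((toL2 F K c₀).symm (DL2 F n K c₀ U₀ u)) μ))) p‖
        ≤ 2 * (exists_curved_localHessian.choose *
            (Mw + ((2 * Real.sqrt 2 * (4 * ε₀ * (3 + 2457 * norm_bgOfCfg_axialT_sub_le.choose)) * Nω + Hω)
              + 2 * Real.sqrt 2 * ((4 * ε₀ * (3 + 2457 * norm_bgOfCfg_axialT_sub_le.choose)) * Mw + (48 * ε₀) * (3 * Real.sqrt 10 * (2 * Real.sqrt 2 * (48 * ε₀) * Mw))))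
            + (6 * Real.sqrt 2 * (48 * ε₀) * (Nω + 2 * Real.sqrt 2 * (48 * ε₀) * Mw + 2 * Real.sqrt 2 * (48 * ε₀) * Mw) + Mw
              + Real.sqrt 2 * ((2 * ε₀ + 24 * ε₀ ^ 2) * Mu + 12 * ε₀ * Mw)))
          + 2 * Real.sqrt 2 * (48 * ε₀) * Mw) := by
  intro μ
  set M₀ : ℝ := (exists_curved_localHessian.choose *
            (Mw + ((2 * Real.sqrt 2 * (4 * ε₀ * (3 + 2457 * norm_bgOfCfg_axialT_sub_le.choose)) * Nω + Hω)
              + 2 * Real.sqrt 2 * ((4 * ε₀ * (3 + 2457 * norm_bgOfCfg_axialT_sub_le.choose)) * Mw + (48 * ε₀) * (3 * Real.sqrt 10 * (2 * Real.sqrt 2 * (48 * ε₀) * Mw))))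
            + (6 * Real.sqrt 2 * (48 * ε₀) * (Nω + 2 * Real.sqrt 2 * (48 * ε₀) * Mw + 2 * Real.sqrt 2 * (48 * ε₀) * Mw) + Mw
              + Real.sqrt 2 * ((2 * ε₀ + 24 * ε₀ ^ 2) * Mu + 12 * ε₀ * Mw)))
          + 2 * Real.sqrt 2 * (48 * ε₀) * Mw) with hM₀
  have habs := weighted_sup_absorption (ι := Bond 3 (periodsT3 F K))
    (fun p => ‖WL2.equiv ℂ (fun _ : Bond 3 (periodsT3 F K) => c₀) W₂
      (DL2 F n K c₀ U₀ (toL2S F K c₀ (formComp ((toL2 F K c₀).symm (DL2 F n K c₀ U₀ u)) μ))) p‖) (fun _ => (0 : ℝ)) (fun _ => M₀)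
    (fun _ _ => True) (Cg := 1) (a := exists_curved_localHessian.choose * ((48 * ε₀) * (6 * Real.sqrt 2 * Real.sqrt 10 + 6 * Real.sqrt 2)))
    (M := M₀) (κ := 0) (D := 0) le_rfl zero_le_one (fun _ => norm_nonneg _) (fun _ _ _ => by simp)
    (fun p Gb hGb => by
      rw [one_mul]
      exact perBond_hessian_le_of_letters F n K c₀ hε₀ hε1 U₀ hreg u ω hEq hMu0 hNω0 hHω0 hMw0 hMu hNω hMw hHω hroom μ p Gb (fun q => hGb q trivial))
    (fun _ => by rw [zero_mul, neg_zero, Real.exp_zero, mul_one])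
    (by rw [one_mul, zero_mul, Real.exp_zero, mul_one]; exact hsmall)
  intro p
  have := habs p
  rwa [zero_mul, neg_zero, Real.exp_zero, mul_one, mul_one] at this

/-! ## §4 ★★★ The same row in the route's `covGradT` currency — the letter H8 consumes -/

include hε₀ hε1 hreg in
/-- ★★★ **H7 — THE COVARIANT HESSIAN OF A SOLUTION OF `Δ^η_{U₀}u = ω` IN SUP, `covGradT` CURRENCY** (HESS-T1 ✓`Prop7GaugeModeHessianRow.norm_covGradT_DL2_le_of_letters`' conclusion
shape VERBATIM, so the (115)-reading ✓`Prop7ChainPotentialHessianRow.hessRow_chain_of_letters` §3 re-runs on it): for every `μ ν x`,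
`‖covGradT (eta F n K) (bgUnits F K U₀) (toL2⁻¹(D_{U₀}u)) μ ν x‖ ≤ 2·M₀(ε₀; M_u, N_ω, H_ω, M_w)` — §3 read through the dictionary ✓`DL2_toL2S_eq_covDerivFwdT` and operator norm ≤
Frobenius norm ✓`norm_frobEquiv_le`.  The letters: three GLOBAL sups (gauge invariant) and the COVARIANT ½-Hölder letter of `ω` in the local axial gauges (H1–H3, H2 of the H-road).
[cite: Balaban1985BackgroundPropagators, Thm 3.1 (3.42)–(3.44) pp.397–398, (3.3) p.391; Balaban1985Variational, (19) p.281; Balaban1984PropagatorsII, (1.40) p.230] -/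
theorem norm_covGradT_DL2_le_of_holderLetters (u ω : SiteL2K ℂ 3 (periodsT3 F K) c₀ W₂) (hEq : covLapSite F n K c₀ U₀ u = ω)
    {Mu Nω Hω Mw : ℝ} (hMu0 : 0 ≤ Mu) (hNω0 : 0 ≤ Nω) (hHω0 : 0 ≤ Hω) (hMw0 : 0 ≤ Mw)
    (hMu : ∀ y : TSite 3 (periodsT3 F K), ‖WL2.equiv ℂ (fun _ : TSite 3 (periodsT3 F K) => c₀) W₂ u y‖ ≤ Mu)
    (hNω : ∀ y : TSite 3 (periodsT3 F K), ‖WL2.equiv ℂ (fun _ : TSite 3 (periodsT3 F K) => c₀) W₂ ω y‖ ≤ Nω)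
    (hMw : ∀ q : Bond 3 (periodsT3 F K), ‖WL2.equiv ℂ (fun _ : Bond 3 (periodsT3 F K) => c₀) W₂ (DL2 F n K c₀ U₀ u) q‖ ≤ Mw)
    (hHω : ∀ (c : Site (F.P K) 0) (y y' : TSite 3 (periodsT3 F K)),
      tdist (periodsT3 F K) (siteEquiv F K c) y ≤ 4 * (F.L : ℝ) ^ (K - n) + 1 → tdist (periodsT3 F K) (siteEquiv F K c) y' ≤ 4 * (F.L : ℝ) ^ (K - n) + 1 →
      ‖WL2.equiv ℂ (fun _ : TSite 3 (periodsT3 F K) => c₀) W₂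
            (toL2S F K c₀ (fun z => ((axialT U₀ c z : Matrix.specialUnitaryGroup (Fin 2) ℂ) : Matrix (Fin 2) (Fin 2) ℂ) * (toL2S F K c₀).symm ω z
              * star ((axialT U₀ c z : Matrix.specialUnitaryGroup (Fin 2) ℂ) : Matrix (Fin 2) (Fin 2) ℂ))) y'
          - WL2.equiv ℂ (fun _ : TSite 3 (periodsT3 F K) => c₀) W₂
            (toL2S F K c₀ (fun z => ((axialT U₀ c z : Matrix.specialUnitaryGroup (Fin 2) ℂ) : Matrix (Fin 2) (Fin 2) ℂ) * (toL2S F K c₀).symm ω z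
              * star ((axialT U₀ c z : Matrix.specialUnitaryGroup (Fin 2) ℂ) : Matrix (Fin 2) (Fin 2) ℂ))) y‖
        ≤ Hω * (tdist (periodsT3 F K) y y' / ((F.L : ℝ) ^ (K - n))) ^ ((1 : ℝ) / 2))
    (hroom : 2 * (12 * F.L ^ (K - n) + 5) ≤ (F.P K).sitesPerDir 0)
    (hsmall : exists_curved_localHessian.choose * ((48 * ε₀) * (6 * Real.sqrt 2 * Real.sqrt 10 + 6 * Real.sqrt 2)) ≤ 1 / 2)
    (μ ν : Fin (F.P K).d) (x : Site (F.P K) 0) :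
    ‖covGradT (eta F n K) (bgUnits F K U₀) ((toL2 F K c₀).symm (DL2 F n K c₀ U₀ u)) μ ν x‖
      ≤ 2 * (exists_curved_localHessian.choose *
            (Mw + ((2 * Real.sqrt 2 * (4 * ε₀ * (3 + 2457 * norm_bgOfCfg_axialT_sub_le.choose)) * Nω + Hω)
              + 2 * Real.sqrt 2 * ((4 * ε₀ * (3 + 2457 * norm_bgOfCfg_axialT_sub_le.choose)) * Mw + (48 * ε₀) * (3 * Real.sqrt 10 * (2 * Real.sqrt 2 * (48 * ε₀) * Mw))))
            + (6 * Real.sqrt 2 * (48 * ε₀) * (Nω + 2 * Real.sqrt 2 * (48 * ε₀) * Mw + 2 * Real.sqrt 2 * (48 * ε₀) * Mw) + Mw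
              + Real.sqrt 2 * ((2 * ε₀ + 24 * ε₀ ^ 2) * Mu + 12 * ε₀ * Mw)))
          + 2 * Real.sqrt 2 * (48 * ε₀) * Mw) := by
  have hdict : covGradT (eta F n K) (bgUnits F K U₀) ((toL2 F K c₀).symm (DL2 F n K c₀ U₀ u)) μ ν x
      = (toL2 F K c₀).symm (DL2 F n K c₀ U₀ (toL2S F K c₀ (formComp ((toL2 F K c₀).symm (DL2 F n K c₀ U₀ u)) ν))) ⟨x, μ⟩ := by
    rw [DL2_toL2S_eq_covDerivFwdT]; rfl
  rw [hdict, toL2_symm_apply]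
  exact (norm_frobEquiv_le _).trans
    (norm_equiv_DL2_slice_DL2_le_of_letters F n K c₀ hε₀ hε1 U₀ hreg u ω hEq hMu0 hNω0 hHω0 hMw0 hMu hNω hMw hHω hroom hsmall ν _)

end Global

end Summit.QuantumFields.YangMills.Theorems.Prop7SolutionHessianSupOfRegPr

end
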